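import Mathlib
import Literature.Analysis.FunctionSpaces.ContDiffHolderSpace
import Literature.Analysis.FunctionSpaces.ContDiffHolderOne
import Literature.Analysis.FunctionSpaces.ContDiffHolderFDerivCLM
import Literature.Geometry.Symplectic.JHolomorphicRegularityHolderAux
import Summits.SmoothPoincare4.SmoothPoincare4.Theorems.SullivanDualTameOrBrodyR4CoreAChart

/-!
# CORE-A of crux `TameOrBrodyR4` (stmt-SmoothPoincare4-7826), line `Sketch`: the graph part of a
# chart is controlled by the `C^{1,r}` norm (stub `helper_graphSmall`, GS; lead c6, CORE-A wave 4)

CORE-A's family of pencil members is `Φ(b) = u₀ + Ψ · W(b - b₀)` with `W(β) ∈ C^{1,r}_b(ℂ, ℂ²)`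
(`ContDiffHolderFunction ℂ (ℂ × ℂ) 1 r`), where `Ψ` is the adapted frame of the chart
`CoreA.ChartData` at the member `u₀` (smooth, `‖Ψ ξ‖ ≤ C_Ψ`). The local-uniqueness lemma of the
assembly asks for sup-closeness on `ℂ` and `C¹` + `r`-Hölder closeness of the derivatives on a
compact disc; this file provides the purely calculus estimate feeding it: the **graph part**
`ξ ↦ Ψ ξ (W ξ)` satisfies, with a constant `K` depending only on the chart, `r` and the radius `ρ`,

* `‖Ψ ξ (W ξ)‖ ≤ K ‖W‖` on `ℂ`;
* `‖D(Ψ W)(ξ)‖ ≤ K ‖W‖` on the closed `ρ`-disc;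
* `‖D(Ψ W)(ξ) - D(Ψ W)(ξ')‖ ≤ K ‖W‖ ‖ξ - ξ'‖ ^ r` on the closed `ρ`-disc.

Proof: the product rule `D(Ψ W)(ξ) = Ψ ξ ∘ DW(ξ) + (DΨ(ξ) ·)(W ξ)`; the `C^{1,r}` norm controls
`‖W ξ‖`, `‖DW ξ‖`, the Lipschitz constant of `W` and the Hölder constant of `DW`; `DΨ`, `D²Ψ`
are bounded on the compact `(ρ + 1)`-disc, so `Ψ`, `DΨ` are Lipschitz, hence `r`-Hölder, there
(`Literature.Geometry.Symplectic.holder_on_ball_of_norm_fderiv_le`).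

* `GraphSmall.hasFDerivAt_apply`, `GraphSmall.norm_fderiv_le`,
  `GraphSmall.norm_fderiv_sub_fderiv_le` — the product rule and its two norm forms;
* `GraphSmall.norm_fderiv_sub_fderiv_le_norm_mul_rpow` — `‖DW ξ - DW ξ'‖ ≤ ‖W‖ ‖ξ - ξ'‖ ^ r`
  for `W ∈ C^{1,r}_b`;
* `helper_graphSmall` — the registered stub.
-/

-- the registered namespace `Summit.SmoothPoincare4.SmoothPoincare4.…` repeats a component
set_option linter.dupNamespace false

noncomputable section

open scoped ContDiff Topology NNReal
open Filter Set Metric Literature.Analysis.Complex Literature.Analysis.FunctionSpaces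
  Literature.Geometry.Symplectic

namespace Summit.SmoothPoincare4.SmoothPoincare4.Cruxes.TameOrBrodyR4.Sketch

/-- Local notation for the model space `ℝ⁴ = EuclideanSpace ℝ (Fin 4)`. -/
local notation "E4" => EuclideanSpace ℝ (Fin 4)

namespace GraphSmall

section ProductRule

variable {F G : Type*} [NormedAddCommGroup F] [NormedSpace ℝ F] [NormedAddCommGroup G]
  [NormedSpace ℝ G]

/-- **Product rule** for `ξ ↦ Ψ ξ (v ξ)` (operator field applied to a vector field):
`D(Ψ v)(ξ) = Ψ ξ ∘ Dv(ξ) + (DΨ(ξ) ·)(v ξ)`. -/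
theorem hasFDerivAt_apply {Ψ : ℂ → F →L[ℝ] G} {v : ℂ → F} (hΨ : Differentiable ℝ Ψ)
    (hv : Differentiable ℝ v) (ξ : ℂ) :
    HasFDerivAt (fun y => Ψ y (v y)) ((Ψ ξ).comp (fderiv ℝ v ξ) + (fderiv ℝ Ψ ξ).flip (v ξ)) ξ :=
  (hΨ ξ).hasFDerivAt.clm_apply (hv ξ).hasFDerivAt

/-- **Norm of the derivative of `ξ ↦ Ψ ξ (v ξ)`**: `≤ ‖Ψ ξ‖ ‖Dv ξ‖ + ‖DΨ ξ‖ ‖v ξ‖`. -/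
theorem norm_fderiv_le {Ψ : ℂ → F →L[ℝ] G} {v : ℂ → F} (hΨ : Differentiable ℝ Ψ)
    (hv : Differentiable ℝ v) (ξ : ℂ) :
    ‖fderiv ℝ (fun y => Ψ y (v y)) ξ‖ ≤ ‖Ψ ξ‖ * ‖fderiv ℝ v ξ‖ + ‖fderiv ℝ Ψ ξ‖ * ‖v ξ‖ := by
  rw [(hasFDerivAt_apply hΨ hv ξ).fderiv]
  calc ‖(Ψ ξ).comp (fderiv ℝ v ξ) + (fderiv ℝ Ψ ξ).flip (v ξ)‖
      ≤ ‖(Ψ ξ).comp (fderiv ℝ v ξ)‖ + ‖(fderiv ℝ Ψ ξ).flip (v ξ)‖ := norm_add_le _ _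
    _ ≤ ‖Ψ ξ‖ * ‖fderiv ℝ v ξ‖ + ‖(fderiv ℝ Ψ ξ).flip‖ * ‖v ξ‖ :=
        add_le_add (ContinuousLinearMap.opNorm_comp_le _ _) (ContinuousLinearMap.le_opNorm _ _)
    _ = ‖Ψ ξ‖ * ‖fderiv ℝ v ξ‖ + ‖fderiv ℝ Ψ ξ‖ * ‖v ξ‖ := by
        rw [ContinuousLinearMap.opNorm_flip]

/-- **Difference of the derivatives of `ξ ↦ Ψ ξ (v ξ)` at two points** (four-term product rule):
`‖D(Ψv)(ξ) - D(Ψv)(ξ')‖ ≤ ‖Ψ ξ - Ψ ξ'‖ ‖Dv ξ‖ + ‖Ψ ξ'‖ ‖Dv ξ - Dv ξ'‖ + ‖DΨ ξ - DΨ ξ'‖ ‖v ξ‖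
  + ‖DΨ ξ'‖ ‖v ξ - v ξ'‖`. -/
theorem norm_fderiv_sub_fderiv_le {Ψ : ℂ → F →L[ℝ] G} {v : ℂ → F} (hΨ : Differentiable ℝ Ψ)
    (hv : Differentiable ℝ v) (ξ ξ' : ℂ) :
    ‖fderiv ℝ (fun y => Ψ y (v y)) ξ - fderiv ℝ (fun y => Ψ y (v y)) ξ'‖ ≤
      ‖Ψ ξ - Ψ ξ'‖ * ‖fderiv ℝ v ξ‖ + ‖Ψ ξ'‖ * ‖fderiv ℝ v ξ - fderiv ℝ v ξ'‖ +
        (‖fderiv ℝ Ψ ξ - fderiv ℝ Ψ ξ'‖ * ‖v ξ‖ + ‖fderiv ℝ Ψ ξ'‖ * ‖v ξ - v ξ'‖) := by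
  rw [(hasFDerivAt_apply hΨ hv ξ).fderiv, (hasFDerivAt_apply hΨ hv ξ').fderiv, add_sub_add_comm]
  refine (norm_add_le _ _).trans (add_le_add ?_ ?_)
  · -- the composition term
    have h : (Ψ ξ).comp (fderiv ℝ v ξ) - (Ψ ξ').comp (fderiv ℝ v ξ') =
        (Ψ ξ - Ψ ξ').comp (fderiv ℝ v ξ) + (Ψ ξ').comp (fderiv ℝ v ξ - fderiv ℝ v ξ') := by
      rw [ContinuousLinearMap.sub_comp, ContinuousLinearMap.comp_sub]
      abel
    rw [h]
    exact (norm_add_le _ _).trans (add_le_add (ContinuousLinearMap.opNorm_comp_le _ _)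
      (ContinuousLinearMap.opNorm_comp_le _ _))
  · -- the flipped term
    have h : (fderiv ℝ Ψ ξ).flip (v ξ) - (fderiv ℝ Ψ ξ').flip (v ξ') =
        (fderiv ℝ Ψ ξ - fderiv ℝ Ψ ξ').flip (v ξ) + (fderiv ℝ Ψ ξ').flip (v ξ - v ξ') := by
      ext e
      simp only [sub_apply, add_apply, ContinuousLinearMap.flip_apply, map_sub]
      abel
    rw [h]
    calc ‖(fderiv ℝ Ψ ξ - fderiv ℝ Ψ ξ').flip (v ξ) + (fderiv ℝ Ψ ξ').flip (v ξ - v ξ')‖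
        ≤ ‖(fderiv ℝ Ψ ξ - fderiv ℝ Ψ ξ').flip (v ξ)‖ + ‖(fderiv ℝ Ψ ξ').flip (v ξ - v ξ')‖ :=
          norm_add_le _ _
      _ ≤ ‖(fderiv ℝ Ψ ξ - fderiv ℝ Ψ ξ').flip‖ * ‖v ξ‖ +
            ‖(fderiv ℝ Ψ ξ').flip‖ * ‖v ξ - v ξ'‖ :=
          add_le_add (ContinuousLinearMap.le_opNorm _ _) (ContinuousLinearMap.le_opNorm _ _)
      _ = ‖fderiv ℝ Ψ ξ - fderiv ℝ Ψ ξ'‖ * ‖v ξ‖ + ‖fderiv ℝ Ψ ξ'‖ * ‖v ξ - v ξ'‖ := by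
          rw [ContinuousLinearMap.opNorm_flip, ContinuousLinearMap.opNorm_flip]

end ProductRule

/-- **The derivative of a member of `C^{1,r}_b` is `r`-Hölder with constant `‖W‖`**:
`‖DW ξ - DW ξ'‖ ≤ ‖W‖ ‖ξ - ξ'‖ ^ r` (the Hölder seminorm of `D¹W` is part of the norm). -/
theorem norm_fderiv_sub_fderiv_le_norm_mul_rpow {F : Type*} [NormedAddCommGroup F]
    [NormedSpace ℝ F] {r : ℝ≥0} (W : ContDiffHolderFunction ℂ F 1 r) (ξ ξ' : ℂ) :
    ‖fderiv ℝ (W : ℂ → F) ξ - fderiv ℝ (W : ℂ → F) ξ'‖ ≤ ‖W‖ * ‖ξ - ξ'‖ ^ (r : ℝ) := by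
  have hH : HolderWith (nnHolderNorm r (iteratedFDeriv ℝ 1 (W : ℂ → F))) r
      (fderiv ℝ (W : ℂ → F)) :=
    holderWith_iteratedFDeriv_one_iff.1 W.memHolder.holderWith
  have h := hH.dist_le ξ ξ'
  rw [dist_eq_norm, dist_eq_norm] at h
  exact h.trans (mul_le_mul_of_nonneg_right W.nnHolderNorm_le_norm (by positivity))

end GraphSmall

/-- **Registered stub `helper_graphSmall`: the graph part `ξ ↦ Ψ ξ (W ξ)` of a chart is
controlled by `‖W‖_{C^{1,r}}`.** For chart data `𝒞` (adapted frame `Ψ`, smooth and bounded),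
`0 < r < 1` and a radius `ρ > 0` there is `K > 0` such that for every `W ∈ C^{1,r}_b(ℂ, ℂ²)`:
`‖Ψ ξ (W ξ)‖ ≤ K ‖W‖` on `ℂ`, and on the closed `ρ`-disc `‖D(Ψ W)(ξ)‖ ≤ K ‖W‖` and
`‖D(Ψ W)(ξ) - D(Ψ W)(ξ')‖ ≤ K ‖W‖ ‖ξ - ξ'‖ ^ r` (product rule; `DΨ`, `D²Ψ` bounded on the
compact `(ρ + 1)`-disc). -/
theorem helper_graphSmall (J : E4 → E4 →L[ℝ] E4) (R : ℝ) (P Q : E4 →L[ℝ] ℂ) (eP eQ : ℂ →L[ℝ] E4)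
    (b₀ : ℂ) (u₀ : ℂ → E4) (𝒞 : CoreA.ChartData J R P Q eP eQ b₀ u₀)
    {r : ℝ≥0} (hr0 : 0 < r) (hr1 : r < 1) (ρ : ℝ) (hρ : 0 < ρ) :
    ∃ K > (0 : ℝ), ∀ W : ContDiffHolderFunction ℂ (ℂ × ℂ) 1 r,
      (∀ ξ, ‖𝒞.Ψ ξ (W ξ)‖ ≤ K * ‖W‖) ∧
      (∀ ξ ∈ closedBall (0 : ℂ) ρ, ‖fderiv ℝ (fun y => 𝒞.Ψ y (W y)) ξ‖ ≤ K * ‖W‖) ∧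
      (∀ ξ ∈ closedBall (0 : ℂ) ρ, ∀ ξ' ∈ closedBall (0 : ℂ) ρ,
        ‖fderiv ℝ (fun y => 𝒞.Ψ y (W y)) ξ - fderiv ℝ (fun y => 𝒞.Ψ y (W y)) ξ'‖ ≤
          K * ‖W‖ * ‖ξ - ξ'‖ ^ (r : ℝ)) := by
  have hr0' : (0 : ℝ) ≤ r := by exact_mod_cast hr0.le
  have hr1' : (r : ℝ) ≤ 1 := by exact_mod_cast hr1.le
  -- smoothness of the frame
  have hdΨ : Differentiable ℝ 𝒞.Ψ := 𝒞.hΨs.differentiable (by simp)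
  have hΨ' : ContDiff ℝ ∞ (fderiv ℝ 𝒞.Ψ) := 𝒞.hΨs.fderiv_right (m := ∞) (by simp)
  have hdΨ' : Differentiable ℝ (fderiv ℝ 𝒞.Ψ) := hΨ'.differentiable (by simp)
  -- bounds of `DΨ`, `D²Ψ` on the compact `(ρ + 1)`-disc
  obtain ⟨M₁, hM₁⟩ := (isCompact_closedBall (0 : ℂ) (ρ + 1)).exists_bound_of_continuousOn
    (𝒞.hΨs.continuous_fderiv (by simp)).continuousOn
  obtain ⟨M₂, hM₂⟩ := (isCompact_closedBall (0 : ℂ) (ρ + 1)).exists_bound_of_continuousOn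
    (hΨ'.continuous_fderiv (by simp)).continuousOn
  have h0mem : (0 : ℂ) ∈ closedBall (0 : ℂ) (ρ + 1) := mem_closedBall_self (by linarith)
  have hC0 : 0 ≤ 𝒞.CΨ := (norm_nonneg _).trans (𝒞.hΨbd 0)
  have hM₁0 : 0 ≤ M₁ := (norm_nonneg _).trans (hM₁ 0 h0mem)
  have hM₂0 : 0 ≤ M₂ := (norm_nonneg _).trans (hM₂ 0 h0mem)
  have hsub : closedBall (0 : ℂ) ρ ⊆ ball (0 : ℂ) (ρ + 1) := closedBall_subset_ball (by linarith)
  have hsub' : closedBall (0 : ℂ) ρ ⊆ closedBall (0 : ℂ) (ρ + 1) :=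
    closedBall_subset_closedBall (by linarith)
  -- `Ψ` and `DΨ` are `r`-Hölder on the open `(ρ + 1)`-disc
  set A : ℝ := (2 * (ρ + 1)) ^ (1 - (r : ℝ)) with hA
  have hA0 : 0 ≤ A := Real.rpow_nonneg (by linarith) _
  have hLΨ : ∀ z ∈ ball (0 : ℂ) (ρ + 1), ∀ z' ∈ ball (0 : ℂ) (ρ + 1),
      ‖𝒞.Ψ z - 𝒞.Ψ z'‖ ≤ M₁ * A * ‖z - z'‖ ^ (r : ℝ) := fun z hz z' hz' =>
    holder_on_ball_of_norm_fderiv_le (fun w _ => (hdΨ w)) hr1'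
      (fun w hw => hM₁ w (ball_subset_closedBall hw)) hz hz'
  have hLΨ' : ∀ z ∈ ball (0 : ℂ) (ρ + 1), ∀ z' ∈ ball (0 : ℂ) (ρ + 1),
      ‖fderiv ℝ 𝒞.Ψ z - fderiv ℝ 𝒞.Ψ z'‖ ≤ M₂ * A * ‖z - z'‖ ^ (r : ℝ) := fun z hz z' hz' =>
    holder_on_ball_of_norm_fderiv_le (fun w _ => (hdΨ' w)) hr1'
      (fun w hw => hM₂ w (ball_subset_closedBall hw)) hz hz'
  -- the constant
  refine ⟨2 * 𝒞.CΨ + 4 * M₁ + M₁ * A + M₂ * A + 1, by positivity, fun W => ?_⟩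
  -- what the `C^{1,r}` norm controls
  have hWd : Differentiable ℝ (W : ℂ → ℂ × ℂ) := W.contDiff.differentiable (by simp)
  have hW0 : ∀ z, ‖W z‖ ≤ ‖W‖ := W.norm_apply_le_norm
  have hW1 : ∀ z, ‖fderiv ℝ (W : ℂ → ℂ × ℂ) z‖ ≤ ‖W‖ := W.norm_fderiv_apply_le
  have hWL : ∀ z z', ‖W z - W z'‖ ≤ (2 * ‖W‖ + ‖W‖) * ‖z - z'‖ ^ (r : ℝ) :=
    holder_of_norm_fderiv_le hWd hr0' hr1' hW0 hW1
  have hWH : ∀ z z', ‖fderiv ℝ (W : ℂ → ℂ × ℂ) z - fderiv ℝ (W : ℂ → ℂ × ℂ) z'‖ ≤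
      ‖W‖ * ‖z - z'‖ ^ (r : ℝ) := GraphSmall.norm_fderiv_sub_fderiv_le_norm_mul_rpow W
  have hW : 0 ≤ ‖W‖ := norm_nonneg W
  refine ⟨fun ξ => ?_, fun ξ hξ => ?_, fun ξ hξ ξ' hξ' => ?_⟩
  · -- sup bound on `ℂ`
    calc ‖𝒞.Ψ ξ (W ξ)‖ ≤ ‖𝒞.Ψ ξ‖ * ‖W ξ‖ := (𝒞.Ψ ξ).le_opNorm _
      _ ≤ 𝒞.CΨ * ‖W‖ := mul_le_mul (𝒞.hΨbd ξ) (hW0 ξ) (norm_nonneg _) hC0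
      _ ≤ (2 * 𝒞.CΨ + 4 * M₁ + M₁ * A + M₂ * A + 1) * ‖W‖ := by
          apply mul_le_mul_of_nonneg_right _ hW
          nlinarith [mul_nonneg hM₁0 hA0, mul_nonneg hM₂0 hA0]
  · -- derivative bound on the disc
    calc ‖fderiv ℝ (fun y => 𝒞.Ψ y (W y)) ξ‖
        ≤ ‖𝒞.Ψ ξ‖ * ‖fderiv ℝ (W : ℂ → ℂ × ℂ) ξ‖ + ‖fderiv ℝ 𝒞.Ψ ξ‖ * ‖W ξ‖ :=
          GraphSmall.norm_fderiv_le (Ψ := 𝒞.Ψ) (v := (W : ℂ → ℂ × ℂ)) hdΨ hWd ξ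
      _ ≤ 𝒞.CΨ * ‖W‖ + M₁ * ‖W‖ :=
          add_le_add (mul_le_mul (𝒞.hΨbd ξ) (hW1 ξ) (norm_nonneg _) hC0)
            (mul_le_mul (hM₁ ξ (hsub' hξ)) (hW0 ξ) (norm_nonneg _) hM₁0)
      _ = (𝒞.CΨ + M₁) * ‖W‖ := by ring
      _ ≤ (2 * 𝒞.CΨ + 4 * M₁ + M₁ * A + M₂ * A + 1) * ‖W‖ := by
          apply mul_le_mul_of_nonneg_right _ hW
          nlinarith [mul_nonneg hM₁0 hA0, mul_nonneg hM₂0 hA0]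
  · -- Hölder bound of the derivative on the disc
    have ht0 : 0 ≤ ‖ξ - ξ'‖ ^ (r : ℝ) := Real.rpow_nonneg (norm_nonneg _) _
    have h1 : ‖𝒞.Ψ ξ - 𝒞.Ψ ξ'‖ * ‖fderiv ℝ (W : ℂ → ℂ × ℂ) ξ‖ ≤
        M₁ * A * ‖ξ - ξ'‖ ^ (r : ℝ) * ‖W‖ :=
      mul_le_mul (hLΨ ξ (hsub hξ) ξ' (hsub hξ')) (hW1 ξ) (norm_nonneg _) (by positivity)
    have h2 : ‖𝒞.Ψ ξ'‖ * ‖fderiv ℝ (W : ℂ → ℂ × ℂ) ξ - fderiv ℝ (W : ℂ → ℂ × ℂ) ξ'‖ ≤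
        𝒞.CΨ * (‖W‖ * ‖ξ - ξ'‖ ^ (r : ℝ)) :=
      mul_le_mul (𝒞.hΨbd ξ') (hWH ξ ξ') (norm_nonneg _) hC0
    have h3 : ‖fderiv ℝ 𝒞.Ψ ξ - fderiv ℝ 𝒞.Ψ ξ'‖ * ‖W ξ‖ ≤
        M₂ * A * ‖ξ - ξ'‖ ^ (r : ℝ) * ‖W‖ :=
      mul_le_mul (hLΨ' ξ (hsub hξ) ξ' (hsub hξ')) (hW0 ξ) (norm_nonneg _) (by positivity)
    have h4 : ‖fderiv ℝ 𝒞.Ψ ξ'‖ * ‖W ξ - W ξ'‖ ≤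
        M₁ * ((2 * ‖W‖ + ‖W‖) * ‖ξ - ξ'‖ ^ (r : ℝ)) :=
      mul_le_mul (hM₁ ξ' (hsub' hξ')) (hWL ξ ξ') (norm_nonneg _) hM₁0
    calc ‖fderiv ℝ (fun y => 𝒞.Ψ y (W y)) ξ - fderiv ℝ (fun y => 𝒞.Ψ y (W y)) ξ'‖
        ≤ ‖𝒞.Ψ ξ - 𝒞.Ψ ξ'‖ * ‖fderiv ℝ (W : ℂ → ℂ × ℂ) ξ‖ +
            ‖𝒞.Ψ ξ'‖ * ‖fderiv ℝ (W : ℂ → ℂ × ℂ) ξ - fderiv ℝ (W : ℂ → ℂ × ℂ) ξ'‖ +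
          (‖fderiv ℝ 𝒞.Ψ ξ - fderiv ℝ 𝒞.Ψ ξ'‖ * ‖W ξ‖ + ‖fderiv ℝ 𝒞.Ψ ξ'‖ * ‖W ξ - W ξ'‖) :=
          GraphSmall.norm_fderiv_sub_fderiv_le (Ψ := 𝒞.Ψ) (v := (W : ℂ → ℂ × ℂ)) hdΨ hWd ξ ξ'
      _ ≤ M₁ * A * ‖ξ - ξ'‖ ^ (r : ℝ) * ‖W‖ + 𝒞.CΨ * (‖W‖ * ‖ξ - ξ'‖ ^ (r : ℝ)) +
          (M₂ * A * ‖ξ - ξ'‖ ^ (r : ℝ) * ‖W‖ + M₁ * ((2 * ‖W‖ + ‖W‖) * ‖ξ - ξ'‖ ^ (r : ℝ))) :=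
          add_le_add (add_le_add h1 h2) (add_le_add h3 h4)
      _ = (𝒞.CΨ + 3 * M₁ + M₁ * A + M₂ * A) * ‖W‖ * ‖ξ - ξ'‖ ^ (r : ℝ) := by ring
      _ ≤ (2 * 𝒞.CΨ + 4 * M₁ + M₁ * A + M₂ * A + 1) * ‖W‖ * ‖ξ - ξ'‖ ^ (r : ℝ) := by
          apply mul_le_mul_of_nonneg_right _ ht0
          apply mul_le_mul_of_nonneg_right _ hW
          linarith

end Summit.SmoothPoincare4.SmoothPoincare4.Cruxes.TameOrBrodyR4.Sketch
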